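import Summits.CriticalPhenomena.PercolationContinuityZ3.Theorems.SahiMasterFamilyTrichotomy

/-!
# Terminal triples: Step A — if every shared coordinate is mandatory for exactly one event, some event is pure

Companion of `SahiMasterFamilyTrichotomy.lean` (unit `prim-master-conj`; terminal analysis of (T), paper STRUCTURE-PROOF.md
§6 Step A, verified VERIFICATION-gen3.md).  Setting: increasing nonempty events `A, B, C` with pairwise-intersecting
essential supports, no private and no common coordinate, all contractions in `Z_3`, and the post-L3 hypothesis that
every shared coordinate `f ∈ esupp X ∩ esupp Y` is MANDATORY for exactly one of `X, Y`.

* `f1_mono`, `f1_strong` — the two consequences of (F1) used: a class `I_XY` with a coordinate mandatory for `X` makes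
  the class `I_XZ` monochromatic; and if moreover all of `I_YZ` is mandatory for `Y`, then no coordinate of `I_XZ` is
  mandatory for `Z`;
* `stepA` — **Step A**: some event is PURE (all its essential coordinates are mandatory for it).  The proof is the
  paper's case analysis (at most one bichromatic class; one bichromatic class forces the opposite event pure; all
  classes monochromatic and no pure event would orient the classes cyclically, which `f1_strong` forbids), run as a
  finite propositional argument on the six statements "`I_XY` has a coordinate mandatory for `X`".
Everything here is proved; axioms standard. [this work]
-/

noncomputable section

open scoped Classical

namespace Summit.CriticalPhenomena.PercolationContinuityZ3.Theorems

open Finset Function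
open Literature.Probability.Percolation (DeterminedBy determinedBy_iff)
open Literature.Probability.LatticeModels.Kahn2022 (Affects)

variable {ι : Type*} [Fintype ι]

/-- **(F1), monochromatic form.**  If some `e ∈ esupp X ∩ esupp Y` is mandatory for `X` (and the contraction at `e`
is in `Z_3`), then the class `esupp X ∩ esupp Z` does not contain both a coordinate mandatory for `X` and one
mandatory for `Z`. [this work] -/
theorem f1_mono {X Y Z : Set (Set ι)} (hX : IsUpperSet X) (hY : IsUpperSet Y) (hZ : IsUpperSet Z)
    (hXne : X.Nonempty) (hYne : Y.Nonempty) (hZne : Z.Nonempty)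
    (hXZ : (esupp X ∩ esupp Z).Nonempty) (hnocommon : ∀ s ∈ esupp X ∩ esupp Z, s ∉ esupp Y)
    {e : ι} (heZ : e ∉ esupp Z) (hmand : secAt e false X = ∅)
    (hK : SuppZeroFlag 3 ![secAt e true X, secAt e true Y, secAt e true Z]) :
    ¬ ((∃ s ∈ esupp X ∩ esupp Z, secAt s false X = ∅) ∧ (∃ s ∈ esupp Z ∩ esupp X, secAt s false Z = ∅)) := by
  rintro ⟨⟨s, hs, hsX⟩, ⟨t, ht, htZ⟩⟩
  rw [inter_comm] at ht
  rcases lemma_F1 hX hY hZ hXne hYne hZne hXZ hnocommon heZ hmand hK with ⟨-, h⟩ | ⟨-, h⟩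
  · exact (Set.nonempty_iff_ne_empty.1 (h t ht)) htZ
  · exact (Set.nonempty_iff_ne_empty.1 (h s hs)) hsX

/-- **(F1), strong form.**  If some `e ∈ esupp X ∩ esupp Y` is mandatory for `X`, and EVERY coordinate of
`esupp Y ∩ esupp Z ≠ ∅` is mandatory for `Y`, then no coordinate of `esupp X ∩ esupp Z` is mandatory for `Z`.
[this work] -/
theorem f1_strong {X Y Z : Set (Set ι)} (hX : IsUpperSet X) (hY : IsUpperSet Y) (hZ : IsUpperSet Z)
    (hXne : X.Nonempty) (hYne : Y.Nonempty) (hZne : Z.Nonempty)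
    (hXZ : (esupp X ∩ esupp Z).Nonempty) (hYZ : (esupp Y ∩ esupp Z).Nonempty)
    (hnocommon : ∀ s ∈ esupp X ∩ esupp Z, s ∉ esupp Y)
    {e : ι} (heZ : e ∉ esupp Z) (hmand : secAt e false X = ∅)
    (hK : SuppZeroFlag 3 ![secAt e true X, secAt e true Y, secAt e true Z])
    (hQ : ∀ t ∈ esupp Y ∩ esupp Z, secAt t false Y = ∅) :
    ¬ ∃ s ∈ esupp Z ∩ esupp X, secAt s false Z = ∅ := by
  rintro ⟨s, hs, hsZ⟩
  rw [inter_comm] at hs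
  rcases lemma_F1 hX hY hZ hXne hYne hZne hXZ hnocommon heZ hmand hK with ⟨-, h⟩ | ⟨h, -⟩
  · exact (Set.nonempty_iff_ne_empty.1 (h s hs)) hsZ
  · obtain ⟨t, ht⟩ := hYZ
    have htZ := (mem_inter.1 ht).2
    have hte : e ≠ t := fun h' => heZ (h' ▸ htZ)
    have htY1 : t ∈ esupp (secAt e true Y) := affects_secAt_true_of_mandatory hY hYne hte (hQ t ht)
    exact Finset.disjoint_left.1 h htY1 htZ

/-- **Step A.**  Increasing nonempty events `A, B, C` with pairwise-intersecting essential supports, no private and no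
common coordinate, all contractions in `Z_3`, such that every shared coordinate is mandatory for exactly one of its two
events: then one of the three events is PURE — every coordinate of its essential support is mandatory for it.
[this work] -/
theorem stepA {A B C : Set (Set ι)} (hA : IsUpperSet A) (hB : IsUpperSet B) (hC : IsUpperSet C)
    (hAne : A.Nonempty) (hBne : B.Nonempty) (hCne : C.Nonempty)
    (hAB : (esupp A ∩ esupp B).Nonempty) (hAC : (esupp A ∩ esupp C).Nonempty) (hBC : (esupp B ∩ esupp C).Nonempty)
    (hprivA : esupp A ⊆ esupp B ∪ esupp C) (hprivB : esupp B ⊆ esupp A ∪ esupp C)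
    (hprivC : esupp C ⊆ esupp A ∪ esupp B) (hcommon : ∀ i, i ∈ esupp A → i ∈ esupp B → i ∉ esupp C)
    (hmin : ∀ i ∈ esupp A ∪ esupp B ∪ esupp C, SuppZeroFlag 3 ![secAt i true A, secAt i true B, secAt i true C])
    (hGAB : ∀ f, f ∈ esupp A → f ∈ esupp B → (secAt f false A = ∅ ↔ secAt f false B ≠ ∅))
    (hGAC : ∀ f, f ∈ esupp A → f ∈ esupp C → (secAt f false A = ∅ ↔ secAt f false C ≠ ∅))
    (hGBC : ∀ f, f ∈ esupp B → f ∈ esupp C → (secAt f false B = ∅ ↔ secAt f false C ≠ ∅)) :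
    (∀ f ∈ esupp A, secAt f false A = ∅) ∨ (∀ f ∈ esupp B, secAt f false B = ∅) ∨
      (∀ f ∈ esupp C, secAt f false C = ∅) := by
  -- the six permuted minor families
  have up : ∀ (X : Set (Set ι)) (i : ι), IsUpperSet X → IsUpperSet (secAt i true X) :=
    fun X i h => isUpperSet_secAt i true h
  set W := esupp A ∪ esupp B ∪ esupp C with hW
  have hBAC : ∀ i ∈ W, SuppZeroFlag 3 ![secAt i true B, secAt i true A, secAt i true C] :=
    fun i hi => (suppZeroFlag_three_swap12 (up A i hA) (up B i hB) (up C i hC)).1 (hmin i hi)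
  have hACB : ∀ i ∈ W, SuppZeroFlag 3 ![secAt i true A, secAt i true C, secAt i true B] :=
    fun i hi => (suppZeroFlag_three_swap23 (up A i hA) (up B i hB) (up C i hC)).1 (hmin i hi)
  have hCAB : ∀ i ∈ W, SuppZeroFlag 3 ![secAt i true C, secAt i true A, secAt i true B] :=
    fun i hi => (suppZeroFlag_three_swap12 (up A i hA) (up C i hC) (up B i hB)).1 (hACB i hi)
  have hBCA : ∀ i ∈ W, SuppZeroFlag 3 ![secAt i true B, secAt i true C, secAt i true A] :=
    fun i hi => (suppZeroFlag_three_swap23 (up B i hB) (up A i hA) (up C i hC)).1 (hBAC i hi)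
  have hCBA : ∀ i ∈ W, SuppZeroFlag 3 ![secAt i true C, secAt i true B, secAt i true A] :=
    fun i hi => (suppZeroFlag_three_swap12 (up B i hB) (up C i hC) (up A i hA)).1 (hBCA i hi)
  have wA : ∀ {i}, i ∈ esupp A → i ∈ W := fun h => by simp [hW, h]
  have wB : ∀ {i}, i ∈ esupp B → i ∈ W := fun h => by simp [hW, h]
  have wC : ∀ {i}, i ∈ esupp C → i ∈ W := fun h => by simp [hW, h]
  -- symmetric forms of the hypotheses
  have hBA : (esupp B ∩ esupp A).Nonempty := by rwa [inter_comm]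
  have hCA : (esupp C ∩ esupp A).Nonempty := by rwa [inter_comm]
  have hCB : (esupp C ∩ esupp B).Nonempty := by rwa [inter_comm]
  have ncAB : ∀ s ∈ esupp A ∩ esupp B, s ∉ esupp C := fun s hs => hcommon s (mem_inter.1 hs).1 (mem_inter.1 hs).2
  have ncBA : ∀ s ∈ esupp B ∩ esupp A, s ∉ esupp C := fun s hs => hcommon s (mem_inter.1 hs).2 (mem_inter.1 hs).1
  have ncAC : ∀ s ∈ esupp A ∩ esupp C, s ∉ esupp B :=
    fun s hs h => hcommon s (mem_inter.1 hs).1 h (mem_inter.1 hs).2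
  have ncCA : ∀ s ∈ esupp C ∩ esupp A, s ∉ esupp B :=
    fun s hs h => hcommon s (mem_inter.1 hs).2 h (mem_inter.1 hs).1
  have ncBC : ∀ s ∈ esupp B ∩ esupp C, s ∉ esupp A :=
    fun s hs h => hcommon s h (mem_inter.1 hs).1 (mem_inter.1 hs).2
  have ncCB : ∀ s ∈ esupp C ∩ esupp B, s ∉ esupp A :=
    fun s hs h => hcommon s h (mem_inter.1 hs).2 (mem_inter.1 hs).1
  -- the six atoms `P X Y`: "some coordinate of `esupp X ∩ esupp Y` is mandatory for `X`"
  set pAB := ∃ s ∈ esupp A ∩ esupp B, secAt s false A = ∅ with hpAB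
  set pBA := ∃ s ∈ esupp B ∩ esupp A, secAt s false B = ∅ with hpBA
  set pAC := ∃ s ∈ esupp A ∩ esupp C, secAt s false A = ∅ with hpAC
  set pCA := ∃ s ∈ esupp C ∩ esupp A, secAt s false C = ∅ with hpCA
  set pBC := ∃ s ∈ esupp B ∩ esupp C, secAt s false B = ∅ with hpBC
  set pCB := ∃ s ∈ esupp C ∩ esupp B, secAt s false C = ∅ with hpCB
  -- each class has a mandatory coordinate for one side
  have cAB : pAB ∨ pBA := by
    obtain ⟨f, hf⟩ := hAB
    by_cases h : secAt f false A = ∅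
    · exact Or.inl ⟨f, hf, h⟩
    · refine Or.inr ⟨f, by rwa [inter_comm], ?_⟩
      by_contra h'
      exact h ((hGAB f (mem_inter.1 hf).1 (mem_inter.1 hf).2).2 h')
  have cAC : pAC ∨ pCA := by
    obtain ⟨f, hf⟩ := hAC
    by_cases h : secAt f false A = ∅
    · exact Or.inl ⟨f, hf, h⟩
    · refine Or.inr ⟨f, by rwa [inter_comm], ?_⟩
      by_contra h'
      exact h ((hGAC f (mem_inter.1 hf).1 (mem_inter.1 hf).2).2 h')
  have cBC : pBC ∨ pCB := by
    obtain ⟨f, hf⟩ := hBC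
    by_cases h : secAt f false B = ∅
    · exact Or.inl ⟨f, hf, h⟩
    · refine Or.inr ⟨f, by rwa [inter_comm], ?_⟩
      by_contra h'
      exact h ((hGBC f (mem_inter.1 hf).1 (mem_inter.1 hf).2).2 h')
  -- "all of `I_XY` mandatory for `X`" from "nothing of `I_YX` mandatory for `Y`"
  have qAB : ¬ pBA → ∀ t ∈ esupp A ∩ esupp B, secAt t false A = ∅ := fun h t ht =>
    (hGAB t (mem_inter.1 ht).1 (mem_inter.1 ht).2).2 fun h' => h ⟨t, by rwa [inter_comm], h'⟩
  have qBA : ¬ pAB → ∀ t ∈ esupp B ∩ esupp A, secAt t false B = ∅ := fun h t ht => by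
    by_contra h'
    exact h ⟨t, by rwa [inter_comm], (hGAB t (mem_inter.1 ht).2 (mem_inter.1 ht).1).2 h'⟩
  have qAC : ¬ pCA → ∀ t ∈ esupp A ∩ esupp C, secAt t false A = ∅ := fun h t ht =>
    (hGAC t (mem_inter.1 ht).1 (mem_inter.1 ht).2).2 fun h' => h ⟨t, by rwa [inter_comm], h'⟩
  have qCA : ¬ pAC → ∀ t ∈ esupp C ∩ esupp A, secAt t false C = ∅ := fun h t ht => by
    by_contra h'
    exact h ⟨t, by rwa [inter_comm], (hGAC t (mem_inter.1 ht).2 (mem_inter.1 ht).1).2 h'⟩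
  have qBC : ¬ pCB → ∀ t ∈ esupp B ∩ esupp C, secAt t false B = ∅ := fun h t ht =>
    (hGBC t (mem_inter.1 ht).1 (mem_inter.1 ht).2).2 fun h' => h ⟨t, by rwa [inter_comm], h'⟩
  have qCB : ¬ pBC → ∀ t ∈ esupp C ∩ esupp B, secAt t false C = ∅ := fun h t ht => by
    by_contra h'
    exact h ⟨t, by rwa [inter_comm], (hGBC t (mem_inter.1 ht).2 (mem_inter.1 ht).1).2 h'⟩
  -- (F1) monochromatic: P X Y → ¬ (P X Z ∧ P Z X)
  have mABC : pAB → ¬ (pAC ∧ pCA) := fun ⟨e, he, hm⟩ =>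
    f1_mono hA hB hC hAne hBne hCne hAC ncAC (ncAB e he) hm (hmin e (wA (mem_inter.1 he).1))
  have mBAC : pBA → ¬ (pBC ∧ pCB) := fun ⟨e, he, hm⟩ =>
    f1_mono hB hA hC hBne hAne hCne hBC ncBC (ncBA e he) hm (hBAC e (wB (mem_inter.1 he).1))
  have mACB : pAC → ¬ (pAB ∧ pBA) := fun ⟨e, he, hm⟩ =>
    f1_mono hA hC hB hAne hCne hBne hAB ncAB (ncAC e he) hm (hACB e (wA (mem_inter.1 he).1))
  have mCAB : pCA → ¬ (pCB ∧ pBC) := fun ⟨e, he, hm⟩ =>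
    f1_mono hC hA hB hCne hAne hBne hCB ncCB (ncCA e he) hm (hCAB e (wC (mem_inter.1 he).1))
  have mBCA : pBC → ¬ (pBA ∧ pAB) := fun ⟨e, he, hm⟩ =>
    f1_mono hB hC hA hBne hCne hAne hBA ncBA (ncBC e he) hm (hBCA e (wB (mem_inter.1 he).1))
  have mCBA : pCB → ¬ (pCA ∧ pAC) := fun ⟨e, he, hm⟩ =>
    f1_mono hC hB hA hCne hBne hAne hCA ncCA (ncCB e he) hm (hCBA e (wC (mem_inter.1 he).1))
  -- (F1) strong: P X Y → Q Y Z → ¬ P Z X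
  have sABC : pAB → (∀ t ∈ esupp B ∩ esupp C, secAt t false B = ∅) → ¬ pCA := fun ⟨e, he, hm⟩ hq =>
    f1_strong hA hB hC hAne hBne hCne hAC hBC ncAC (ncAB e he) hm (hmin e (wA (mem_inter.1 he).1)) hq
  have sBAC : pBA → (∀ t ∈ esupp A ∩ esupp C, secAt t false A = ∅) → ¬ pCB := fun ⟨e, he, hm⟩ hq =>
    f1_strong hB hA hC hBne hAne hCne hBC hAC ncBC (ncBA e he) hm (hBAC e (wB (mem_inter.1 he).1)) hq
  have sACB : pAC → (∀ t ∈ esupp C ∩ esupp B, secAt t false C = ∅) → ¬ pBA := fun ⟨e, he, hm⟩ hq =>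
    f1_strong hA hC hB hAne hCne hBne hAB hCB ncAB (ncAC e he) hm (hACB e (wA (mem_inter.1 he).1)) hq
  have sCAB : pCA → (∀ t ∈ esupp A ∩ esupp B, secAt t false A = ∅) → ¬ pBC := fun ⟨e, he, hm⟩ hq =>
    f1_strong hC hA hB hCne hAne hBne hCB hAB ncCB (ncCA e he) hm (hCAB e (wC (mem_inter.1 he).1)) hq
  have sBCA : pBC → (∀ t ∈ esupp C ∩ esupp A, secAt t false C = ∅) → ¬ pAB := fun ⟨e, he, hm⟩ hq =>
    f1_strong hB hC hA hBne hCne hAne hBA hCA ncBA (ncBC e he) hm (hBCA e (wB (mem_inter.1 he).1)) hq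
  have sCBA : pCB → (∀ t ∈ esupp B ∩ esupp A, secAt t false B = ∅) → ¬ pAC := fun ⟨e, he, hm⟩ hq =>
    f1_strong hC hB hA hCne hBne hAne hCA hBA ncCA (ncCB e he) hm (hCBA e (wC (mem_inter.1 he).1)) hq
  -- purity from the atoms
  have pureA : ¬ pBA → ¬ pCA → ∀ f ∈ esupp A, secAt f false A = ∅ := by
    intro h1 h2 f hf
    rcases mem_union.1 (hprivA hf) with hfB | hfC
    · exact qAB h1 f (mem_inter.2 ⟨hf, hfB⟩)
    · exact qAC h2 f (mem_inter.2 ⟨hf, hfC⟩)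
  have pureB : ¬ pAB → ¬ pCB → ∀ f ∈ esupp B, secAt f false B = ∅ := by
    intro h1 h2 f hf
    rcases mem_union.1 (hprivB hf) with hfA | hfC
    · exact qBA h1 f (mem_inter.2 ⟨hf, hfA⟩)
    · exact qBC h2 f (mem_inter.2 ⟨hf, hfC⟩)
  have pureC : ¬ pAC → ¬ pBC → ∀ f ∈ esupp C, secAt f false C = ∅ := by
    intro h1 h2 f hf
    rcases mem_union.1 (hprivC hf) with hfA | hfB
    · exact qCA h1 f (mem_inter.2 ⟨hf, hfA⟩)
    · exact qCB h2 f (mem_inter.2 ⟨hf, hfB⟩)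
  -- strong rules in atomic form
  have tABC : pAB → ¬ pCB → ¬ pCA := fun h1 h2 => sABC h1 (qBC h2)
  have tBAC : pBA → ¬ pCA → ¬ pCB := fun h1 h2 => sBAC h1 (qAC h2)
  have tACB : pAC → ¬ pBC → ¬ pBA := fun h1 h2 => sACB h1 (qCB h2)
  have tCAB : pCA → ¬ pBA → ¬ pBC := fun h1 h2 => sCAB h1 (qAB h2)
  have tBCA : pBC → ¬ pAC → ¬ pAB := fun h1 h2 => sBCA h1 (qCA h2)
  have tCBA : pCB → ¬ pAB → ¬ pAC := fun h1 h2 => sCBA h1 (qBA h2)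
  -- the finite case analysis (propositional)
  have key : (¬ pBA ∧ ¬ pCA) ∨ (¬ pAB ∧ ¬ pCB) ∨ (¬ pAC ∧ ¬ pBC) := by
    by_cases xBA : pBA
    · by_cases xCA : pCA
      · by_cases xAB : pAB
        · by_cases xCB : pCB
          · by_cases xAC : pAC
            · by_cases xBC : pBC
              · exact (mABC xAB ⟨xAC, xCA⟩).elim
              · exact (mABC xAB ⟨xAC, xCA⟩).elim
            · by_cases xBC : pBC
              · exact (mBAC xBA ⟨xBC, xCB⟩).elim
              · exact Or.inr (Or.inr ⟨xAC, xBC⟩)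
          · by_cases xAC : pAC
            · by_cases xBC : pBC
              · exact (mABC xAB ⟨xAC, xCA⟩).elim
              · exact (cBC.elim xBC xCB).elim
            · by_cases xBC : pBC
              · exact (mBCA xBC ⟨xBA, xAB⟩).elim
              · exact Or.inr (Or.inr ⟨xAC, xBC⟩)
        · by_cases xCB : pCB
          · by_cases xAC : pAC
            · by_cases xBC : pBC
              · exact (mBAC xBA ⟨xBC, xCB⟩).elim
              · exact (mCBA xCB ⟨xCA, xAC⟩).elim
            · by_cases xBC : pBC
              · exact (mBAC xBA ⟨xBC, xCB⟩).elim
              · exact Or.inr (Or.inr ⟨xAC, xBC⟩)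
          · by_cases xAC : pAC
            · by_cases xBC : pBC
              · exact Or.inr (Or.inl ⟨xAB, xCB⟩)
              · exact Or.inr (Or.inl ⟨xAB, xCB⟩)
            · by_cases xBC : pBC
              · exact Or.inr (Or.inl ⟨xAB, xCB⟩)
              · exact Or.inr (Or.inl ⟨xAB, xCB⟩)
      · by_cases xAB : pAB
        · by_cases xCB : pCB
          · by_cases xAC : pAC
            · by_cases xBC : pBC
              · exact (mBAC xBA ⟨xBC, xCB⟩).elim
              · exact (mACB xAC ⟨xAB, xBA⟩).elim
            · by_cases xBC : pBC
              · exact (cAC.elim xAC xCA).elim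
              · exact Or.inr (Or.inr ⟨xAC, xBC⟩)
          · by_cases xAC : pAC
            · by_cases xBC : pBC
              · exact (mACB xAC ⟨xAB, xBA⟩).elim
              · exact (cBC.elim xBC xCB).elim
            · by_cases xBC : pBC
              · exact (cAC.elim xAC xCA).elim
              · exact Or.inr (Or.inr ⟨xAC, xBC⟩)
        · by_cases xCB : pCB
          · by_cases xAC : pAC
            · by_cases xBC : pBC
              · exact (mBAC xBA ⟨xBC, xCB⟩).elim
              · exact (tBAC xBA xCA xCB).elim
            · by_cases xBC : pBC
              · exact (cAC.elim xAC xCA).elim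
              · exact Or.inr (Or.inr ⟨xAC, xBC⟩)
          · by_cases xAC : pAC
            · by_cases xBC : pBC
              · exact Or.inr (Or.inl ⟨xAB, xCB⟩)
              · exact Or.inr (Or.inl ⟨xAB, xCB⟩)
            · by_cases xBC : pBC
              · exact Or.inr (Or.inl ⟨xAB, xCB⟩)
              · exact Or.inr (Or.inl ⟨xAB, xCB⟩)
    · by_cases xCA : pCA
      · by_cases xAB : pAB
        · by_cases xCB : pCB
          · by_cases xAC : pAC
            · by_cases xBC : pBC
              · exact (mABC xAB ⟨xAC, xCA⟩).elim
              · exact (mABC xAB ⟨xAC, xCA⟩).elim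
            · by_cases xBC : pBC
              · exact (mCAB xCA ⟨xCB, xBC⟩).elim
              · exact Or.inr (Or.inr ⟨xAC, xBC⟩)
          · by_cases xAC : pAC
            · by_cases xBC : pBC
              · exact (mABC xAB ⟨xAC, xCA⟩).elim
              · exact (cBC.elim xBC xCB).elim
            · by_cases xBC : pBC
              · exact (tABC xAB xCB xCA).elim
              · exact Or.inr (Or.inr ⟨xAC, xBC⟩)
        · by_cases xCB : pCB
          · by_cases xAC : pAC
            · by_cases xBC : pBC
              · exact (cAB.elim xAB xBA).elim
              · exact (cAB.elim xAB xBA).elim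
            · by_cases xBC : pBC
              · exact (cAB.elim xAB xBA).elim
              · exact Or.inr (Or.inr ⟨xAC, xBC⟩)
          · by_cases xAC : pAC
            · by_cases xBC : pBC
              · exact Or.inr (Or.inl ⟨xAB, xCB⟩)
              · exact Or.inr (Or.inl ⟨xAB, xCB⟩)
            · by_cases xBC : pBC
              · exact Or.inr (Or.inl ⟨xAB, xCB⟩)
              · exact Or.inr (Or.inl ⟨xAB, xCB⟩)
      · by_cases xAB : pAB
        · by_cases xCB : pCB
          · by_cases xAC : pAC
            · by_cases xBC : pBC
              · exact Or.inl ⟨xBA, xCA⟩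
              · exact Or.inl ⟨xBA, xCA⟩
            · by_cases xBC : pBC
              · exact Or.inl ⟨xBA, xCA⟩
              · exact Or.inl ⟨xBA, xCA⟩
          · by_cases xAC : pAC
            · by_cases xBC : pBC
              · exact Or.inl ⟨xBA, xCA⟩
              · exact Or.inl ⟨xBA, xCA⟩
            · by_cases xBC : pBC
              · exact Or.inl ⟨xBA, xCA⟩
              · exact Or.inl ⟨xBA, xCA⟩
        · by_cases xCB : pCB
          · by_cases xAC : pAC
            · by_cases xBC : pBC
              · exact Or.inl ⟨xBA, xCA⟩
              · exact Or.inl ⟨xBA, xCA⟩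
            · by_cases xBC : pBC
              · exact Or.inl ⟨xBA, xCA⟩
              · exact Or.inl ⟨xBA, xCA⟩
          · by_cases xAC : pAC
            · by_cases xBC : pBC
              · exact Or.inl ⟨xBA, xCA⟩
              · exact Or.inl ⟨xBA, xCA⟩
            · by_cases xBC : pBC
              · exact Or.inl ⟨xBA, xCA⟩
              · exact Or.inl ⟨xBA, xCA⟩
  rcases key with ⟨h1, h2⟩ | ⟨h1, h2⟩ | ⟨h1, h2⟩
  · exact Or.inl (pureA h1 h2)
  · exact Or.inr (Or.inl (pureB h1 h2))
  · exact Or.inr (Or.inr (pureC h1 h2))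

end Summit.CriticalPhenomena.PercolationContinuityZ3.Theorems
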